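import Summits.ValiantsHypothesis.ValiantsHypothesis.Theorems.BarrierLeverPartitionMinorsHitByVPPrimaryContiguous

/-!
# Route BarrierLever — item `PartitionMinorsHitByVP` (stmt-ValiantsHypothesis-19717):
# the additive door as a COMPOSABLE CERTIFICATE — integer door, contiguous leaves, unbalanced split nodes

Helper file (`--supports stmt-ValiantsHypothesis-19717`; cell valiant-natproofs, rung V4, 𝒟-side door (c),
prover seat val-np-p1, gen 10). Closes NO item; definition-free. ENGINE v4 = the three reusable pieces from
which additive-door certificates for a layout `(u, w)` (index type `ι`, `u w : ι → Finset (Fin h)`) are built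
by hand, all about the INTEGER additive matrix `A(u,w) = [∏_{c ∈ w j} (X_(c,none) + Σ_{a ∈ u i} X_(c,some a))]_{i,j}`
over `MvPolynomial (Fin h × Option (Fin h)) ℤ`:

* DOOR `partitionMinor_hit_of_det_additiveZ_ne_zero`: `det A(u,w) ≠ 0` ⇒ `∃ f ∈ SmallCircuits ℂ (h+h) 5` with the
  item's matrix nonsingular (`h ≥ 2`; integer polynomial ≠ 0 ⇒ complex table ⇒ val-np-p6's additive door);
* LEAF `det_additiveZ_ne_zero_of_primaryContiguous'` (`ι`-indexed form of `…PrimaryContiguous`): `u` injective,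
  columns `p`-ary contiguous (`Σ_{c ∈ w j \ Z} p^{e c} = n j` for a bijection `n : ι ≃ Fin r`) ⇒ `det A ≠ 0`;
  in particular `|ι| = 1` always (`det_additiveZ_ne_zero_of_card_eq_one`);
* NODE `det_additiveZ_ne_zero_of_split` (UNBALANCED fiber lemma): a column coordinate `c⋆` splits the columns
  into `𝒲₀ = {c⋆ ∉ W}` and `𝒲₁ = {c⋆ ∈ W}` of ANY sizes, an INTEGER affine functional `U ↦ Σ_{k∈U} a_k` takes the
  value `t` exactly on a row set `Z` with `|Z| = |𝒲₀|`; if `det A(Z, 𝒲₀) ≠ 0` and `det A(Zᶜ, {W ∖ c⋆ : W ∈ 𝒲₁}) ≠ 0`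
  then `det A(u,w) ≠ 0`. (Specialising the `c⋆`-variables to the functional makes the reindexed matrix
  `fromBlocks A₀ 0 _ (diagonal s · A₁)` with `s ≠ 0`.) Engines v1/v2 (`IsSplittable`, `IsCoordHalvable`) are the
  balanced special case with singleton leaves; v3 (`…Frobenius/…Contiguous`) is the leaf.

Example of reach beyond v3 + mirror: columns = four singletons `{a},{b},{c},{d}` (never contiguous) × rows any
four sets with a hyperplane section of size 3 (i.e. not coplanar) — exactly the additive door's true domain there
(coplanar rows make `A` identically singular). WHAT THIS IS NOT: no claim that every layout has a certificate
(the additive door does not reach all layouts); item 19717 stays open; nothing on CPM, crux 14610 or VP vs VNP.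
-/

set_option linter.dupNamespace false

namespace Summit.ValiantsHypothesis.ValiantsHypothesis.Theorems.BarrierLever.SubsetSum

open Finset MvPolynomial Literature.Barriers.ValiantsHypothesis
open Summit.ValiantsHypothesis.ValiantsHypothesis.Theorems.BarrierLever.AdditiveDoor
  (partitionMinor_hit_of_additive_mem partitionMinor_hit_symm)

noncomputable section

variable {h : ℕ}

/-! ## 1. The door from the integer additive matrix -/

/-- **INTEGER DOOR.** If the integer additive matrix of a layout has nonzero determinant, the layout is hit in
`SmallCircuits ℂ (h+h) 5` (`h ≥ 2`). -/
theorem partitionMinor_hit_of_det_additiveZ_ne_zero (hh : 2 ≤ h) {ι : Type*} [Fintype ι] [DecidableEq ι]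
    (u w : ι → Finset (Fin h))
    (hdet : (Matrix.of fun i j : ι =>
      (∏ c ∈ w j, (X (c, none) + ∑ a ∈ u i, X (c, some a)) :
        MvPolynomial (Fin h × Option (Fin h)) ℤ)).det ≠ 0) :
    ∃ f ∈ SmallCircuits ℂ (h + h) 5,
      (Matrix.of fun i j : ι => MvPolynomial.coeff
        (∑ a ∈ u i, Finsupp.single (Fin.castAdd h a) 1 +
          ∑ c ∈ w j, Finsupp.single (Fin.natAdd h c) 1) f).det ≠ 0 := by
  set P : MvPolynomial (Fin h × Option (Fin h)) ℤ := (Matrix.of fun i j : ι =>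
      (∏ c ∈ w j, (X (c, none) + ∑ a ∈ u i, X (c, some a)) :
        MvPolynomial (Fin h × Option (Fin h)) ℤ)).det with hP
  have hPC : MvPolynomial.map (Int.castRingHom ℂ) P ≠ 0 := fun h0 =>
    hdet (MvPolynomial.map_injective (Int.castRingHom ℂ) Int.cast_injective (by rw [h0, map_zero]))
  have : ∃ x : Fin h × Option (Fin h) → ℂ, eval x (MvPolynomial.map (Int.castRingHom ℂ) P) ≠ 0 := by
    by_contra hcon
    push Not at hcon
    exact hPC (MvPolynomial.funext fun x => by rw [hcon x, map_zero])
  obtain ⟨x, hx⟩ := this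
  refine partitionMinor_hit_of_additive_mem h hh u w (fun c => x (c, none)) (fun a c => x (c, some a)) ?_
  rw [MvPolynomial.eval_map, ← coe_eval₂Hom, hP, RingHom.map_det] at hx
  convert hx using 2
  refine Matrix.ext fun i j => ?_
  simp only [Matrix.of_apply, RingHom.mapMatrix_apply, Matrix.map_apply, map_prod, map_add, map_sum,
    eval₂Hom_X']

/-! ## 2. Leaves -/

/-- **LEAF (`ι`-indexed).** Injective rows × `p`-ary-contiguous columns (weights enumerated by a bijection
`n : ι ≃ Fin r`): the integer additive matrix is nonsingular. -/
theorem det_additiveZ_ne_zero_of_primaryContiguous' (p : ℕ) [Fact p.Prime] {ι : Type*} [Fintype ι]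
    [DecidableEq ι] {r : ℕ} (n : ι ≃ Fin r) (u w : ι → Finset (Fin h)) (hu : Function.Injective u)
    (Z : Finset (Fin h)) (e : Fin h → ℕ) (hw : ∀ j, ∑ c ∈ w j \ Z, p ^ e c = (n j : ℕ)) :
    (Matrix.of fun i j : ι =>
      (∏ c ∈ w j, (X (c, none) + ∑ a ∈ u i, X (c, some a)) :
        MvPolynomial (Fin h × Option (Fin h)) ℤ)).det ≠ 0 := by
  have key := det_additiveZ_ne_zero_of_primaryContiguous p (fun k => u (n.symm k)) (fun k => w (n.symm k))
    (fun k k' hkk' => n.symm.injective (hu hkk')) Z e (Equiv.refl _) (fun k => by simpa using hw (n.symm k))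
  intro h0
  apply key
  have hmat : (Matrix.of fun i j : Fin r =>
      (∏ c ∈ w (n.symm j), (X (c, none) + ∑ a ∈ u (n.symm i), X (c, some a)) :
        MvPolynomial (Fin h × Option (Fin h)) ℤ)) =
      (Matrix.of fun i j : ι =>
        (∏ c ∈ w j, (X (c, none) + ∑ a ∈ u i, X (c, some a)) :
          MvPolynomial (Fin h × Option (Fin h)) ℤ)).submatrix n.symm n.symm := by
    refine Matrix.ext fun i j => ?_
    simp [Matrix.submatrix_apply]
  rw [hmat, Matrix.det_submatrix_equiv_self, h0]

/-- **LEAF of size one.** A `1 × 1` additive matrix is a product of nonzero linear forms. -/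
theorem det_additiveZ_ne_zero_of_card_eq_one {ι : Type*} [Fintype ι] [DecidableEq ι]
    (hι : Fintype.card ι = 1) (u w : ι → Finset (Fin h)) :
    (Matrix.of fun i j : ι =>
      (∏ c ∈ w j, (X (c, none) + ∑ a ∈ u i, X (c, some a)) :
        MvPolynomial (Fin h × Option (Fin h)) ℤ)).det ≠ 0 := by
  have n : ι ≃ Fin 1 := Fintype.equivOfCardEq (by rw [hι, Fintype.card_fin])
  refine det_additiveZ_ne_zero_of_primaryContiguous' 2 n u w
    (fun i j _ => n.injective (Subsingleton.elim _ _)) Finset.univ (fun _ => 0) fun j => ?_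
  simp

/-! ## 3. The unbalanced split node -/

/-- **NODE (unbalanced fiber lemma).** Columns split by membership of `c⋆` (along `eγ : ι₀ ⊕ ι₁ ≃ ι`:
`inl` = without `c⋆`, `inr` = with `c⋆`), rows split by the integer affine functional `U ↦ Σ_{k ∈ U} a k`
(along `eρ`: `inl` = value `t`, `inr` = value `≠ t`). If the two diagonal blocks — `(Z rows) × (𝒲₀)` and
`(other rows) × (𝒲₁ with c⋆ erased)` — have nonzero integer determinants, so does the whole matrix. -/
theorem det_additiveZ_ne_zero_of_split {ι ι₀ ι₁ : Type*} [Fintype ι] [DecidableEq ι] [Fintype ι₀]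
    [DecidableEq ι₀] [Fintype ι₁] [DecidableEq ι₁] (u w : ι → Finset (Fin h)) (cstar : Fin h)
    (a : Fin h → ℤ) (t : ℤ) (eρ eγ : ι₀ ⊕ ι₁ ≃ ι)
    (hZ : ∀ i₀ : ι₀, ∑ k ∈ u (eρ (Sum.inl i₀)), a k = t)
    (hY : ∀ i₁ : ι₁, ∑ k ∈ u (eρ (Sum.inr i₁)), a k ≠ t)
    (h0 : ∀ j₀ : ι₀, cstar ∉ w (eγ (Sum.inl j₀)))
    (h1 : ∀ j₁ : ι₁, cstar ∈ w (eγ (Sum.inr j₁)))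
    (hdet₀ : (Matrix.of fun i j : ι₀ =>
      (∏ c ∈ w (eγ (Sum.inl j)), (X (c, none) + ∑ a ∈ u (eρ (Sum.inl i)), X (c, some a)) :
        MvPolynomial (Fin h × Option (Fin h)) ℤ)).det ≠ 0)
    (hdet₁ : (Matrix.of fun i j : ι₁ =>
      (∏ c ∈ (w (eγ (Sum.inr j))).erase cstar,
        (X (c, none) + ∑ a ∈ u (eρ (Sum.inr i)), X (c, some a)) :
          MvPolynomial (Fin h × Option (Fin h)) ℤ)).det ≠ 0) :
    (Matrix.of fun i j : ι =>
      (∏ c ∈ w j, (X (c, none) + ∑ a ∈ u i, X (c, some a)) :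
        MvPolynomial (Fin h × Option (Fin h)) ℤ)).det ≠ 0 := by
  -- the specialisation of the `c⋆`-variables to the functional
  let g : Fin h × Option (Fin h) → MvPolynomial (Fin h × Option (Fin h)) ℤ := fun q =>
    if q.1 = cstar then Option.elim q.2 (C (-t)) (fun k => C (a k)) else X q
  let φ : MvPolynomial (Fin h × Option (Fin h)) ℤ →ₐ[ℤ] MvPolynomial (Fin h × Option (Fin h)) ℤ := aeval g
  -- its effect on a linear form
  have hφlin : ∀ (c : Fin h) (U : Finset (Fin h)),
      φ (X (c, none) + ∑ k ∈ U, X (c, some k)) =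
        if c = cstar then C (-t + ∑ k ∈ U, a k) else X (c, none) + ∑ k ∈ U, X (c, some k) := by
    intro c U
    simp only [φ, map_add, map_sum, aeval_X, g]
    split_ifs with hc
    · simp [Option.elim]
    · rfl
  -- its effect on an entry
  have hφentry : ∀ (U W : Finset (Fin h)),
      φ (∏ c ∈ W, (X (c, none) + ∑ k ∈ U, X (c, some k))) =
        (if cstar ∈ W then C (-t + ∑ k ∈ U, a k) else 1) *
          ∏ c ∈ W.erase cstar, (X (c, none) + ∑ k ∈ U, X (c, some k)) := by
    intro U W
    rw [map_prod]
    have herase : ∏ c ∈ W.erase cstar, φ (X (c, none) + ∑ k ∈ U, X (c, some k)) =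
        ∏ c ∈ W.erase cstar, (X (c, none) + ∑ k ∈ U, X (c, some k)) := by
      refine Finset.prod_congr rfl fun c hc => ?_
      rw [hφlin, if_neg (Finset.ne_of_mem_erase hc)]
    split_ifs with hW
    · rw [← Finset.mul_prod_erase W _ hW, hφlin, if_pos rfl, herase]
    · rw [one_mul, ← herase, Finset.erase_eq_of_notMem hW]
  -- the scalars of the rows
  have hsZ : ∀ i₀ : ι₀, (-t + ∑ k ∈ u (eρ (Sum.inl i₀)), a k) = 0 := fun i₀ => by
    rw [hZ i₀]; ring
  have hsY : ∀ i₁ : ι₁, (-t + ∑ k ∈ u (eρ (Sum.inr i₁)), a k) ≠ 0 := fun i₁ h0 =>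
    hY i₁ (by linarith)
  -- the specialised, reindexed matrix is block triangular
  set M : Matrix ι ι (MvPolynomial (Fin h × Option (Fin h)) ℤ) := Matrix.of fun i j : ι =>
      (∏ c ∈ w j, (X (c, none) + ∑ a ∈ u i, X (c, some a)) :
        MvPolynomial (Fin h × Option (Fin h)) ℤ) with hM
  let d : ι₁ → MvPolynomial (Fin h × Option (Fin h)) ℤ := fun i₁ =>
    C (-t + ∑ k ∈ u (eρ (Sum.inr i₁)), a k)
  let M₀ : Matrix ι₀ ι₀ (MvPolynomial (Fin h × Option (Fin h)) ℤ) := Matrix.of fun i j : ι₀ =>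
      ∏ c ∈ w (eγ (Sum.inl j)), (X (c, none) + ∑ a ∈ u (eρ (Sum.inl i)), X (c, some a))
  let M₁ : Matrix ι₁ ι₁ (MvPolynomial (Fin h × Option (Fin h)) ℤ) := Matrix.of fun i j : ι₁ =>
      ∏ c ∈ (w (eγ (Sum.inr j))).erase cstar, (X (c, none) + ∑ a ∈ u (eρ (Sum.inr i)), X (c, some a))
  let B : Matrix ι₁ ι₀ (MvPolynomial (Fin h × Option (Fin h)) ℤ) := Matrix.of fun i j =>
      ∏ c ∈ w (eγ (Sum.inl j)), (X (c, none) + ∑ a ∈ u (eρ (Sum.inr i)), X (c, some a))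
  have hblock : (φ.toRingHom.mapMatrix M).submatrix eρ eγ =
      Matrix.fromBlocks M₀ 0 B (Matrix.diagonal d * M₁) := by
    refine Matrix.ext fun x y => ?_
    rcases x with i | i <;> rcases y with j | j
    · simp only [Matrix.submatrix_apply, Matrix.fromBlocks_apply₁₁, RingHom.mapMatrix_apply,
        Matrix.map_apply, AlgHom.toRingHom_eq_coe, RingHom.coe_coe, hM, Matrix.of_apply, hφentry,
        if_neg (h0 j), one_mul, Finset.erase_eq_of_notMem (h0 j), M₀]
    · simp only [Matrix.submatrix_apply, Matrix.fromBlocks_apply₁₂, RingHom.mapMatrix_apply,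
        Matrix.map_apply, AlgHom.toRingHom_eq_coe, RingHom.coe_coe, hM, Matrix.of_apply, hφentry,
        if_pos (h1 j), hsZ i, map_zero, zero_mul, Matrix.zero_apply]
    · simp only [Matrix.submatrix_apply, Matrix.fromBlocks_apply₂₁, RingHom.mapMatrix_apply,
        Matrix.map_apply, AlgHom.toRingHom_eq_coe, RingHom.coe_coe, hM, Matrix.of_apply, hφentry,
        if_neg (h0 j), one_mul, Finset.erase_eq_of_notMem (h0 j), B]
    · simp only [Matrix.submatrix_apply, Matrix.fromBlocks_apply₂₂, RingHom.mapMatrix_apply,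
        Matrix.map_apply, AlgHom.toRingHom_eq_coe, RingHom.coe_coe, hM, Matrix.of_apply, hφentry,
        if_pos (h1 j), Matrix.diagonal_mul, M₁, d]
  have hd : ∀ i₁, d i₁ ≠ 0 := fun i₁ => by
    simp only [d, ne_eq, C_eq_zero]
    exact hsY i₁
  have hdet_block : ((φ.toRingHom.mapMatrix M).submatrix eρ eγ).det ≠ 0 := by
    rw [hblock, Matrix.det_fromBlocks_zero₁₂, Matrix.det_mul, Matrix.det_diagonal]
    exact mul_ne_zero hdet₀ (mul_ne_zero (Finset.prod_ne_zero_iff.mpr fun i _ => hd i) hdet₁)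
  have hdetφ : (φ.toRingHom.mapMatrix M).det ≠ 0 := det_ne_zero_of_submatrix _ eρ eγ hdet_block
  intro hzero
  apply hdetφ
  rw [← RingHom.map_det, hzero, map_zero]

/-! ## 4. A worked certificate: one unbalanced split with contiguous leaves -/

/-- **ONE SPLIT, TWO CONTIGUOUS LEAVES ⇒ hit.** Columns split by `c⋆` into a `p`-ary-contiguous family
(without `c⋆`) and a family whose members minus `c⋆` are `p`-ary contiguous, of ANY two sizes; rows injective
with an integer hyperplane section of the matching size. -/
theorem partitionMinor_hit_of_oneSplit (hh : 2 ≤ h) (p : ℕ) [Fact p.Prime] {ι ι₀ ι₁ : Type*} [Fintype ι]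
    [DecidableEq ι] [Fintype ι₀] [DecidableEq ι₀] [Fintype ι₁] [DecidableEq ι₁] {r₀ r₁ : ℕ}
    (u w : ι → Finset (Fin h)) (hu : Function.Injective u) (cstar : Fin h) (a : Fin h → ℤ) (t : ℤ)
    (eρ eγ : ι₀ ⊕ ι₁ ≃ ι) (n₀ : ι₀ ≃ Fin r₀) (n₁ : ι₁ ≃ Fin r₁)
    (hZ : ∀ i₀ : ι₀, ∑ k ∈ u (eρ (Sum.inl i₀)), a k = t)
    (hY : ∀ i₁ : ι₁, ∑ k ∈ u (eρ (Sum.inr i₁)), a k ≠ t)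
    (h0 : ∀ j₀ : ι₀, cstar ∉ w (eγ (Sum.inl j₀)))
    (h1 : ∀ j₁ : ι₁, cstar ∈ w (eγ (Sum.inr j₁)))
    (Z₀ : Finset (Fin h)) (e₀ : Fin h → ℕ) (hw₀ : ∀ j₀, ∑ c ∈ w (eγ (Sum.inl j₀)) \ Z₀, p ^ e₀ c = (n₀ j₀ : ℕ))
    (Z₁ : Finset (Fin h)) (e₁ : Fin h → ℕ)
    (hw₁ : ∀ j₁, ∑ c ∈ (w (eγ (Sum.inr j₁))).erase cstar \ Z₁, p ^ e₁ c = (n₁ j₁ : ℕ)) :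
    ∃ f ∈ SmallCircuits ℂ (h + h) 5,
      (Matrix.of fun i j : ι => MvPolynomial.coeff
        (∑ a ∈ u i, Finsupp.single (Fin.castAdd h a) 1 +
          ∑ c ∈ w j, Finsupp.single (Fin.natAdd h c) 1) f).det ≠ 0 := by
  refine partitionMinor_hit_of_det_additiveZ_ne_zero hh u w ?_
  refine det_additiveZ_ne_zero_of_split u w cstar a t eρ eγ hZ hY h0 h1 ?_ ?_
  · exact det_additiveZ_ne_zero_of_primaryContiguous' p n₀ (fun i => u (eρ (Sum.inl i)))
      (fun j => w (eγ (Sum.inl j))) (fun i i' hii' => Sum.inl_injective (eρ.injective (hu hii')))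
      Z₀ e₀ hw₀
  · exact det_additiveZ_ne_zero_of_primaryContiguous' p n₁ (fun i => u (eρ (Sum.inr i)))
      (fun j => (w (eγ (Sum.inr j))).erase cstar)
      (fun i i' hii' => Sum.inr_injective (eρ.injective (hu hii'))) Z₁ e₁ hw₁

end

end Summit.ValiantsHypothesis.ValiantsHypothesis.Theorems.BarrierLever.SubsetSum
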